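import Literature.Topology.FourManifolds.CircleMapWinding
import Mathlib.Topology.Covering.Quotient
import Mathlib.Algebra.Group.Equiv.Opposite
import HarnessLib

/-!
# The infinite cyclic cover defined by a circle-valued map

Topic `Literature/Topology/FourManifolds`, continuing `CircleMapWinding.lean` (angle increments
and winding numbers of a circle-valued map `f : X → S¹`). First module of the covering-space road
(D. Rolfsen, *Knots and Links* (1976), Ch. 7 "Infinite cyclic coverings"; W. B. R. Lickorish, *An
introduction to knot theory* (1997), Ch. 6–7; A. Hatcher, *Algebraic Topology* (2002), §1.3) to the
presentation of the Alexander module of a knot group by a Seifert matrix — the geometric half of the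
named facts `Literature.Topology.FourManifolds.exists_eq_mul_invert_of_isSmoothlySlice`,
`exists_eq_mul_invert_of_isTopologicallySlice` (Fox–Milnor) and
`Literature.Topology.FourManifolds.Knot.exists_isAlexanderPolynomial` (see `AlexanderModuleHNN.lean`,
`SliceKnotsFoxMilnorHNN.lean`, `KnotGroupAbelianization.lean` for the algebraic half).

For a continuous `f : X → S¹` (Mathlib's `Circle`, with the covering `Circle.exp : ℝ → S¹` of
period `2π`) we construct

* `CircleMaps.windingHom f x : π₁(X, x) →* ℤ` (multiplicative `ℤ`) — the **winding homomorphism**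
  `[γ] ↦ winding f γ` (`f_* : π₁(X) → π₁(S¹) = ℤ`; well defined by homotopy lifting, Hatcher
  Prop. 1.30, a homomorphism by additivity of increments);
* `CircleMaps.CyclicCover f = {(x, s) ∈ X × ℝ | f x = exp s}` — the **infinite cyclic cover**
  defined by `f` (the pull-back of `exp : ℝ → S¹` along `f`), with its projection `proj`, its level
  function `level : CyclicCover f → ℝ` (a real lift of `f ∘ proj`) and the **deck action** of `ℤ`,
  `k +ᵥ (x, s) = (x, s + 2πk)`;

and prove (everything is proved, no named fact is introduced):

* `CyclicCover.isAddQuotientCoveringMap_proj` — `proj : CyclicCover f → X` is a quotient covering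
  map for the deck action (Mathlib `IsAddQuotientCoveringMap`: continuous local sections make `proj`
  open; the fibres are the `ℤ`-orbits by `exp s = exp s' ↔ s - s' ∈ 2πℤ`; the slab `|s' - s| < π` is
  disjoint from its translates), hence a covering map (Hatcher §1.3, Prop. 1.40);
* `CyclicCover.liftPath`, `liftPath_one` — the lift of a path `γ` from a point `e` over `γ 0` is
  `t ↦ (γ t, s(t))` with `s` the real lift of `f ∘ γ`; along a loop it ends at
  `winding f γ +ᵥ e`: **the monodromy of the cover is the winding number**
  (`CyclicCover.monodromy_eq`, `fundamentalGroupToMulOpposite_eq`);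
* `CyclicCover.range_mapOfEq_eq_ker`, `mapOfEq_injective`, `fundamentalGroupEquivKer` —
  **`proj_* : π₁(X̃, e) → π₁(X, proj e)` is injective with image the kernel of the winding
  homomorphism** (Hatcher Prop. 1.31 and Prop. 1.40 in Mathlib's form
  `IsAddQuotientCoveringMap.ker_monodromyPerm`, `ker_fundamentalGroupToMulOpposite`);
* `CyclicCover.pathConnectedSpace_of_winding_eq_one` — if `X` is path connected and some loop has
  winding number `1`, the cover is path connected (so that the Hurewicz theorem applies to it).

For a knot `K` with the circle-valued map `Θ` of `Knot.TubularNbhd.WindingData`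
(`LinkingNumberSymmProofs.lean`: `winding Θ γ = φ [γ]`, `[γ]ᵃᵇ = [meridian]ᵃᵇ ^ φ [γ]`) the
kernel of the winding homomorphism is the commutator subgroup of the knot group, so
`CyclicCover Θ` is the infinite cyclic cover of the knot complement and `π₁` of it is the
commutator subgroup `G'` whose abelianisation `G'/G''` is the Alexander module
(`Literature.Topology.FourManifolds.alexanderModule`); that identification, with the deck action
matching the `ℤ[t, t⁻¹]`-structure, is the business of the sibling file on the homology of the
cover.

## References

* A. Hatcher, *Algebraic Topology*, CUP (2002), §1.1 Thm. 1.7, §1.3 Props. 1.30, 1.31, 1.33,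
  1.39, 1.40. [HatcherAT2002]
* D. Rolfsen, *Knots and Links*, Publish or Perish (1976), §5.C–D, Ch. 7. [Rolfsen1976]
* W. B. R. Lickorish, *An Introduction to Knot Theory*, GTM 175 (1997), Ch. 6–7. [Lickorish1997]

## Design notes

* The cover is a subtype of `X × ℝ` (not a quotient), so paths in it are pairs (path in `X`, real
  lift); the deck action is an `AddAction ℤ` as in `MappingTorusCovering.lean`, and the monodromy
  theory is Mathlib's (`Mathlib/Topology/Homotopy/Lifting.lean`).
* `windingHom` is defined elementarily (winding numbers, `CircleMapWinding.lean`) and only then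
  identified with Mathlib's `fundamentalGroupToMulOpposite` of the cover; in particular it does not
  depend on a point of the fibre.
-/

noncomputable section

open Set Function Filter
open scoped unitInterval Real Topology

namespace Literature.Topology.FourManifolds

/-- Local notation for the homotopy class of a path (Mathlib's simp normal form
`Path.Homotopic.Quotient.mk`). -/
local notation "⟦" p "⟧ₚ" => Path.Homotopic.Quotient.mk p

namespace CircleMaps

variable {X : Type*} [TopologicalSpace X]

/-! ### Homotopy invariance of winding numbers; the winding homomorphism -/

/-- **Additivity of winding numbers under concatenation of loops.** [folklore] -/
theorem winding_trans (f : C(X, Circle)) {x : X} (γ γ' : Path x x) :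
    winding f (γ.trans γ') = winding f γ + winding f γ' := by
  rw [winding_eq_iff, incr_trans, incr_eq_winding, incr_eq_winding]
  push_cast
  ring

/-- The winding number of the reversed loop. [folklore] -/
theorem winding_symm (f : C(X, Circle)) {x : X} (γ : Path x x) :
    winding f γ.symm = -winding f γ := by
  rw [winding_eq_iff, incr_symm, incr_eq_winding]
  push_cast
  ring

/-- The constant loop has winding number zero. [folklore] -/
theorem winding_refl (f : C(X, Circle)) (x : X) : winding f (Path.refl x) = 0 := by
  rw [winding_eq_iff, incr_refl]
  simp

/-- **Homotopy invariance of the winding number** (Hatcher 2002, Prop. 1.30: lifts of homotopic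
loops starting at the same point end at the same point; Mathlib
`IsCoveringMap.liftPath_apply_one_eq_of_homotopicRel` for `exp : ℝ → S¹`).
[cite: HatcherAT2002, Prop. 1.30] -/
theorem winding_eq_of_homotopic (f : C(X, Circle)) {x : X} {γ γ' : Path x x}
    (h : γ.Homotopic γ') : winding f γ = winding f γ' := by
  have hrel : (f.comp γ.toContinuousMap).HomotopicRel (f.comp γ'.toContinuousMap) {0, 1} :=
    ⟨(h.some.map f : Path.Homotopy (γ.map f.continuous) (γ'.map f.continuous))⟩
  have h1 : liftOf f γ 1 = liftOf f γ' 1 :=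
    Circle.isCoveringMap_exp.liftPath_apply_one_eq_of_homotopicRel hrel _
      (comp_path_zero_eq f γ) (comp_path_zero_eq f γ')
  have h0 : liftOf f γ 0 = liftOf f γ' 0 := by
    rw [liftOf, liftOf, Circle.isCoveringMap_exp.liftPath_zero,
      Circle.isCoveringMap_exp.liftPath_zero]
  apply winding_eq_of_lift f γ (liftOf f γ).continuous (exp_liftOf f γ)
  rw [h1, h0]
  exact incr_eq_winding f γ'

/-- **The winding homomorphism** `π₁(X, x) → ℤ` of a circle-valued map `f`, `[γ] ↦ winding f γ`
(the induced map `f_* : π₁(X, x) → π₁(S¹) ≅ ℤ`, Hatcher 2002, Thm. 1.7), valued in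
`Multiplicative ℤ`. [cite: HatcherAT2002, §1.1 Thm. 1.7] -/
def windingHom (f : C(X, Circle)) (x : X) : FundamentalGroup X x →* Multiplicative ℤ where
  toFun g := Quotient.liftOn (FundamentalGroup.toPath g)
    (fun γ : Path x x => Multiplicative.ofAdd (winding f γ))
    fun _ _ h => congrArg Multiplicative.ofAdd (winding_eq_of_homotopic f h)
  map_one' := by
    change Multiplicative.ofAdd (winding f (Path.refl x)) = 1
    rw [winding_refl]
    rfl
  map_mul' a b := by
    induction a using Quotient.inductionOn with | h a => ?_
    induction b using Quotient.inductionOn with | h b => ?_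
    change Multiplicative.ofAdd (winding f (b.trans a)) =
      Multiplicative.ofAdd (winding f a) * Multiplicative.ofAdd (winding f b)
    rw [winding_trans, add_comm, ofAdd_add]

/-- The winding homomorphism on the class of a loop. [folklore] -/
@[simp]
theorem windingHom_fromPath (f : C(X, Circle)) {x : X} (γ : Path x x) :
    windingHom f x (FundamentalGroup.fromPath ⟦γ⟧ₚ) = Multiplicative.ofAdd (winding f γ) :=
  rfl

/-- A loop of winding number `1` makes the winding homomorphism surjective. [folklore] -/
theorem windingHom_surjective_of_winding_eq_one (f : C(X, Circle)) {x : X} (γ : Path x x)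
    (h : winding f γ = 1) : Surjective (windingHom f x) := by
  intro k
  refine ⟨FundamentalGroup.fromPath ⟦γ⟧ₚ ^ (Multiplicative.toAdd k), ?_⟩
  rw [map_zpow, windingHom_fromPath, h]
  change Multiplicative.ofAdd (1 : ℤ) ^ (Multiplicative.toAdd k) = k
  rw [← Int.ofAdd_mul, one_mul, ofAdd_toAdd]

/-! ### The infinite cyclic cover -/

/-- **The infinite cyclic cover defined by `f : X → S¹`**: the pull-back
`{(x, s) ∈ X × ℝ | f x = exp s}` of the universal cover `exp : ℝ → S¹` along `f`
(Rolfsen 1976, Ch. 7; Hatcher 2002, §1.3). [cite: HatcherAT2002, §1.3 Prop. 1.40] -/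
def CyclicCover (f : C(X, Circle)) : Type _ :=
  {p : X × ℝ // f p.1 = Circle.exp p.2}

namespace CyclicCover

variable {f : C(X, Circle)}

/-- The subspace topology from `X × ℝ`. [folklore] -/
instance instTopologicalSpace : TopologicalSpace (CyclicCover f) :=
  instTopologicalSpaceSubtype

/-- The covering projection `(x, s) ↦ x`. [folklore] -/
def proj (p : CyclicCover f) : X := p.1.1

/-- The level `(x, s) ↦ s`, a real lift of `f ∘ proj` through `exp`. [folklore] -/
def level (p : CyclicCover f) : ℝ := p.1.2

/-- The defining equation `f (proj p) = exp (level p)`. [folklore] -/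
theorem apply_proj (p : CyclicCover f) : f (proj p) = Circle.exp (level p) := p.2

/-- Points of the cover are determined by their two coordinates. [folklore] -/
@[ext]
theorem ext {p q : CyclicCover f} (h₁ : proj p = proj q) (h₂ : level p = level q) : p = q :=
  Subtype.ext (Prod.ext h₁ h₂)

/-- The point `(x, s)` of the cover, for `f x = exp s`. [folklore] -/
def mk (x : X) (s : ℝ) (h : f x = Circle.exp s) : CyclicCover f := ⟨(x, s), h⟩

/-- First coordinate of `mk`. [folklore] -/
@[simp] theorem proj_mk (x : X) (s : ℝ) (h : f x = Circle.exp s) : proj (mk x s h) = x := rfl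

/-- Second coordinate of `mk`. [folklore] -/
@[simp] theorem level_mk (x : X) (s : ℝ) (h : f x = Circle.exp s) : level (mk x s h) = s := rfl

/-- `mk` recovers a point from its coordinates. [folklore] -/
@[simp] theorem mk_proj_level (p : CyclicCover f) : mk (proj p) (level p) (apply_proj p) = p := rfl

/-- The projection is continuous. [folklore] -/
@[fun_prop]
theorem continuous_proj : Continuous (proj : CyclicCover f → X) :=
  continuous_subtype_val.fst

/-- The level is continuous. [folklore] -/
@[fun_prop]
theorem continuous_level : Continuous (level : CyclicCover f → ℝ) :=
  continuous_subtype_val.snd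

/-- A map into the cover is continuous when its two coordinates are. [folklore] -/
theorem continuous_mk {Y : Type*} [TopologicalSpace Y] {g : Y → X} {s : Y → ℝ}
    (hg : Continuous g) (hs : Continuous s) (h : ∀ y, f (g y) = Circle.exp (s y)) :
    Continuous fun y => mk (g y) (s y) (h y) :=
  (hg.prodMk hs).subtype_mk _

/-- Continuity at a point of a map into the cover from that of its coordinates. [folklore] -/
theorem continuousAt_mk {Y : Type*} [TopologicalSpace Y] {g : Y → X} {s : Y → ℝ} {y : Y}
    (hg : ContinuousAt g y) (hs : ContinuousAt s y) (h : ∀ y, f (g y) = Circle.exp (s y)) :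
    ContinuousAt (fun y => mk (g y) (s y) (h y)) y :=
  tendsto_subtype_rng.2 (hg.prodMk_nhds hs)

/-- The projection as a bundled continuous map. [folklore] -/
def projC (f : C(X, Circle)) : C(CyclicCover f, X) := ⟨proj, continuous_proj⟩

/-- `projC` is `proj`. [folklore] -/
@[simp] theorem projC_apply (p : CyclicCover f) : projC f p = proj p := rfl

/-- **The base point over `x`**: `(x, arg (f x))`. [folklore] -/
def base (f : C(X, Circle)) (x : X) : CyclicCover f :=
  mk x ((f x : ℂ).arg) (by rw [Circle.exp_arg])

/-- The base point lies over `x`. [folklore] -/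
@[simp] theorem proj_base (x : X) : proj (base f x) = x := rfl

/-- The projection is surjective. [folklore] -/
theorem proj_surjective : Surjective (proj : CyclicCover f → X) := fun x => ⟨base f x, rfl⟩

/-- The cover of a nonempty space is nonempty. [folklore] -/
instance instNonempty [Nonempty X] : Nonempty (CyclicCover f) :=
  ⟨base f (Classical.arbitrary X)⟩

/-! ### The deck action of `ℤ` -/

/-- **The deck action** `k +ᵥ (x, s) = (x, s + 2πk)` of `ℤ` on the cover (Hatcher 2002, §1.3,
deck transformations). [cite: HatcherAT2002, §1.3 Prop. 1.39] -/
instance instAddAction : AddAction ℤ (CyclicCover f) where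
  vadd k p := mk (proj p) (level p + k * (2 * π))
    (by rw [Circle.exp_add, Circle.exp_int_mul_two_pi, mul_one]; exact apply_proj p)
  zero_vadd p := by
    change mk (proj p) (level p + ((0 : ℤ) : ℝ) * (2 * π)) _ = p
    exact CyclicCover.ext rfl (by simp)
  add_vadd k l p := by
    change mk (proj p) (level p + ((k + l : ℤ) : ℝ) * (2 * π)) _ =
      mk (proj p) (level p + (l : ℝ) * (2 * π) + (k : ℝ) * (2 * π)) _
    exact CyclicCover.ext rfl (by simp only [level_mk]; push_cast; ring)

/-- The deck action does not move the first coordinate. [folklore] -/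
@[simp] theorem proj_vadd (k : ℤ) (p : CyclicCover f) : proj (k +ᵥ p) = proj p := rfl

/-- The deck action shifts the level by `2πk`. [folklore] -/
@[simp] theorem level_vadd (k : ℤ) (p : CyclicCover f) :
    level (k +ᵥ p) = level p + k * (2 * π) := rfl

/-- The deck transformations are continuous. [folklore] -/
instance instContinuousConstVAdd : ContinuousConstVAdd ℤ (CyclicCover f) :=
  ⟨fun _ => continuous_mk continuous_proj (continuous_level.add continuous_const) _⟩

/-- Two points with the same projection differ by a deck transformation. [folklore] -/
theorem exists_vadd_eq_of_proj_eq {p q : CyclicCover f} (h : proj p = proj q) :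
    ∃ k : ℤ, k +ᵥ q = p := by
  have he : Circle.exp (level p) = Circle.exp (level q) := by
    rw [← apply_proj, ← apply_proj, h]
  obtain ⟨m, hm⟩ := Circle.exp_eq_exp.1 he
  exact ⟨m, CyclicCover.ext h.symm (by rw [level_vadd, hm])⟩

/-! ### The quotient covering map -/

/-- **Continuous local sections**: through every point `p` of the cover there is a section of
`proj`, defined on all of `X` and continuous at `proj p`, namely
`y ↦ (y, level p + arg (f y / f (proj p)))`. [folklore] -/
theorem exists_section (p : CyclicCover f) :
    ∃ sec : X → CyclicCover f, proj ∘ sec = id ∧ sec (proj p) = p ∧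
      ContinuousAt sec (proj p) := by
  have hmk : ∀ y, f y = Circle.exp (level p + ((f y / f (proj p) : Circle) : ℂ).arg) := by
    intro y
    rw [Circle.exp_add, Circle.exp_arg, ← apply_proj, mul_div_cancel]
  refine ⟨fun y => mk y (level p + ((f y / f (proj p) : Circle) : ℂ).arg) (hmk y), rfl, ?_, ?_⟩
  · exact CyclicCover.ext rfl (by simp)
  · refine continuousAt_mk continuousAt_id (continuousAt_const.add ?_) hmk
    have hc : Continuous fun y => ((f y / f (proj p) : Circle) : ℂ) := by fun_prop
    refine (Complex.continuousAt_arg ?_).comp hc.continuousAt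
    simp

/-- **The projection is an open map** (it has continuous local sections through every point).
[folklore] -/
theorem isOpenMap_proj : IsOpenMap (proj : CyclicCover f → X) := by
  rw [isOpenMap_iff_nhds_le]
  intro p
  obtain ⟨sec, hsec, hsecp, hcont⟩ := exists_section p
  calc 𝓝 (proj p) = map (proj ∘ sec) (𝓝 (proj p)) := by rw [hsec, map_id]
    _ = map proj (map sec (𝓝 (proj p))) := by rw [map_map]
    _ ≤ map proj (𝓝 p) := by
        refine map_mono ?_
        have h := hcont.tendsto
        rwa [hsecp] at h

/-- The projection is a quotient map. [folklore] -/
theorem isQuotientMap_proj : Topology.IsQuotientMap (proj : CyclicCover f → X) :=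
  isOpenMap_proj.isQuotientMap continuous_proj proj_surjective

/-- **The infinite cyclic cover is a quotient covering for the deck action of `ℤ`**: `proj` is a
quotient map, the deck transformations are homeomorphisms, two points have the same projection iff
they lie in one `ℤ`-orbit (`exp s = exp s' ↔ s - s' ∈ 2πℤ`), and the slab `{|s' - s| < π}` around
`(x, s)` is disjoint from its translates by every `k ≠ 0` (Hatcher 2002, §1.3, Prop. 1.40, for the
pull-back of `ℝ → S¹`). [cite: HatcherAT2002, §1.3 Prop. 1.40] -/
theorem isAddQuotientCoveringMap_proj :
    IsAddQuotientCoveringMap (proj : CyclicCover f → X) ℤ where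
  toIsQuotientMap := isQuotientMap_proj
  toContinuousConstVAdd := inferInstance
  apply_eq_iff_mem_orbit {p q} := by
    rw [AddAction.mem_orbit_iff]
    constructor
    · exact exists_vadd_eq_of_proj_eq
    · rintro ⟨m, rfl⟩
      rfl
  disjoint p := by
    refine ⟨{q | |level q - level p| < π}, ?_, ?_⟩
    · refine IsOpen.mem_nhds (isOpen_lt (by fun_prop) continuous_const) ?_
      simp [Real.pi_pos]
    · rintro k ⟨_, ⟨q, hq, rfl⟩, hkq⟩
      simp only [mem_setOf_eq, level_vadd] at hq hkq
      have h2 : |(k : ℝ) * (2 * π)| < 2 * π := by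
        calc |(k : ℝ) * (2 * π)| = |(level q + k * (2 * π) - level p) - (level q - level p)| := by
              ring_nf
          _ ≤ |level q + k * (2 * π) - level p| + |level q - level p| := abs_sub _ _
          _ < π + π := add_lt_add hkq hq
          _ = 2 * π := by ring
      rw [abs_mul, abs_of_pos Real.two_pi_pos] at h2
      have h3 : |(k : ℝ)| < 1 :=
        lt_of_mul_lt_mul_right (by rwa [one_mul]) Real.two_pi_pos.le
      have h4 : |k| < 1 := by exact_mod_cast h3
      exact Int.abs_lt_one_iff.1 h4

/-- **The infinite cyclic cover is a covering space** (Hatcher 2002, Prop. 1.40).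
[cite: HatcherAT2002, §1.3 Prop. 1.40] -/
theorem isCoveringMap_proj : IsCoveringMap (proj : CyclicCover f → X) :=
  isAddQuotientCoveringMap_proj.isCoveringMap

/-! ### Lifted paths and the monodromy -/

section Lifts

variable {x y : X}

/-- The point `e` lies over the source of `γ`, in the form needed to lift. [folklore] -/
theorem comp_path_zero_eq_exp_level (γ : Path x y) (e : CyclicCover f) (he : proj e = x) :
    (f.comp γ.toContinuousMap) 0 = Circle.exp (level e) := by
  simp [← he, apply_proj]

/-- **The real lift** of `f ∘ γ` through `exp : ℝ → S¹` starting at `level e`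
(Hatcher 2002, Prop. 1.30). [cite: HatcherAT2002, Prop. 1.30] -/
def realLift (γ : Path x y) (e : CyclicCover f) (he : proj e = x) : C(I, ℝ) :=
  Circle.isCoveringMap_exp.liftPath (f.comp γ.toContinuousMap) (level e)
    (comp_path_zero_eq_exp_level γ e he)

/-- The real lift lifts `f ∘ γ`. [folklore] -/
theorem exp_realLift (γ : Path x y) (e : CyclicCover f) (he : proj e = x) (t : I) :
    Circle.exp (realLift γ e he t) = f (γ t) :=
  (congr_fun (Circle.isCoveringMap_exp.liftPath_lifts (f.comp γ.toContinuousMap) (level e)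
    (comp_path_zero_eq_exp_level γ e he)) t :)

/-- The real lift starts at `level e`. [folklore] -/
@[simp]
theorem realLift_zero (γ : Path x y) (e : CyclicCover f) (he : proj e = x) :
    realLift γ e he 0 = level e :=
  Circle.isCoveringMap_exp.liftPath_zero _ _ _

/-- The increment of `f` along `γ` is read off the real lift. [folklore] -/
theorem realLift_one_sub (γ : Path x y) (e : CyclicCover f) (he : proj e = x) :
    realLift γ e he 1 - level e = incr f γ := by
  rw [incr_eq_of_lift f γ (realLift γ e he).continuous (exp_realLift γ e he), realLift_zero]

/-- The end point of the lifted path. [folklore] -/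
def liftEnd (γ : Path x y) (e : CyclicCover f) (he : proj e = x) : CyclicCover f :=
  mk y (realLift γ e he 1) (by rw [exp_realLift, γ.target])

/-- The end point lies over the target. [folklore] -/
@[simp] theorem proj_liftEnd (γ : Path x y) (e : CyclicCover f) (he : proj e = x) :
    proj (liftEnd γ e he) = y := rfl

/-- The level of the end point is `level e + incr f γ`. [folklore] -/
theorem level_liftEnd (γ : Path x y) (e : CyclicCover f) (he : proj e = x) :
    level (liftEnd γ e he) = level e + incr f γ := by
  rw [← realLift_one_sub γ e he]
  simp [liftEnd]

/-- **The lifted path** `t ↦ (γ t, s t)` of `γ` from the point `e` over `γ 0`, `s` the real lift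
of `f ∘ γ` from `level e` (path lifting, Hatcher 2002, Prop. 1.30). [cite: HatcherAT2002, Prop. 1.30] -/
def liftPath (γ : Path x y) (e : CyclicCover f) (he : proj e = x) : Path e (liftEnd γ e he) where
  toFun t := mk (γ t) (realLift γ e he t) (exp_realLift γ e he t).symm
  continuous_toFun := continuous_mk γ.continuous (realLift γ e he).continuous _
  source' := CyclicCover.ext (by simp [he]) (by simp)
  target' := CyclicCover.ext (by simp) rfl

/-- The lifted path lifts `γ`. [folklore] -/
@[simp] theorem proj_liftPath (γ : Path x y) (e : CyclicCover f) (he : proj e = x) (t : I) :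
    proj (liftPath γ e he t) = γ t := rfl

/-- The level along the lifted path is the real lift. [folklore] -/
@[simp] theorem level_liftPath (γ : Path x y) (e : CyclicCover f) (he : proj e = x) (t : I) :
    level (liftPath γ e he t) = realLift γ e he t := rfl

/-- The lifted path projects to `γ`. [folklore] -/
theorem map_liftPath (γ : Path x y) (e : CyclicCover f) (he : proj e = x) :
    (liftPath γ e he).map continuous_proj = γ.cast he rfl := by
  ext t
  rfl

/-- **Uniqueness of lifts**: a path in the cover is determined by its starting point and its
projection (Hatcher 2002, Prop. 1.34; Mathlib `IsCoveringMap.eq_liftPath_iff'`).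
[cite: HatcherAT2002, Prop. 1.30] -/
theorem path_eq_of_proj_eq {e e₁ e₂ : CyclicCover f} (Γ₁ : Path e e₁) (Γ₂ : Path e e₂)
    (h : ∀ t, proj (Γ₁ t) = proj (Γ₂ t)) (t : I) : Γ₁ t = Γ₂ t := by
  have h₁ := (isCoveringMap_proj.eq_liftPath_iff' (γ := (projC f).comp Γ₂.toContinuousMap)
    (e := e) (γ_0 := by simp) (Γ := Γ₁.toContinuousMap)).2 ⟨by ext s; exact h s, Γ₁.source⟩
  have h₂ := (isCoveringMap_proj.eq_liftPath_iff' (γ := (projC f).comp Γ₂.toContinuousMap)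
    (e := e) (γ_0 := by simp) (Γ := Γ₂.toContinuousMap)).2 ⟨rfl, Γ₂.source⟩
  have := congr_fun (congrArg DFunLike.coe (h₁.trans h₂.symm)) t
  simpa using this

/-- A path in the cover starting at `e` is the lift of its projection. [folklore] -/
theorem path_eq_liftPath {e e' : CyclicCover f} (Γ : Path e e') (t : I) :
    Γ t = liftPath (Γ.map continuous_proj) e rfl t :=
  path_eq_of_proj_eq Γ (liftPath (Γ.map continuous_proj) e rfl) (fun _ => rfl) t

/-- **Equivariance of lifts**: translating the starting point by a deck transformation translates
the whole lifted path. [folklore] -/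
theorem vadd_liftPath (k : ℤ) (γ : Path x y) (e : CyclicCover f) (he : proj e = x) (t : I) :
    k +ᵥ liftPath γ e he t = liftPath γ (k +ᵥ e) he t := by
  let Γ : Path (k +ᵥ e) (k +ᵥ liftEnd γ e he) :=
    (liftPath γ e he).map (continuous_const_vadd k)
  exact path_eq_of_proj_eq Γ (liftPath γ (k +ᵥ e) he) (fun _ => rfl) t

/-- The level at the end of the lift of a loop: `level e + 2π · winding f γ`. [folklore] -/
theorem level_liftEnd_loop (γ : Path x x) (e : CyclicCover f) (he : proj e = x) :
    level (liftEnd γ e he) = level e + winding f γ * (2 * π) := by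
  rw [level_liftEnd, incr_eq_winding]

/-- **The lift of a loop ends at the translate of its starting point by the winding number.**
[cite: HatcherAT2002, §1.1 Thm. 1.7] -/
theorem liftEnd_eq_vadd (γ : Path x x) (e : CyclicCover f) (he : proj e = x) :
    liftEnd γ e he = winding f γ +ᵥ e :=
  CyclicCover.ext (by simp [he]) (by rw [level_liftEnd_loop, level_vadd])

/-- **The monodromy of the infinite cyclic cover along a loop is the deck transformation by its
winding number** (Hatcher 2002, §1.3: the action of `π₁(X, x)` on the fibre).
[cite: HatcherAT2002, §1.3 Prop. 1.40] -/
theorem monodromy_eq (γ : Path x x) (e : (proj : CyclicCover f → X) ⁻¹' {x}) :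
    (isCoveringMap_proj (f := f)).monodromy ⟦γ⟧ₚ e =
      ⟨winding f γ +ᵥ e.1, by rw [mem_preimage, proj_vadd]; exact e.2⟩ := by
  have he : proj e.1 = x := e.2
  let Γ : Path e.1 (winding f γ +ᵥ e.1) :=
    (liftPath γ e.1 he).cast rfl (liftEnd_eq_vadd γ e.1 he).symm
  refine isCoveringMap_proj.monodromy_eq_of_map_eq (Γ := ⟦Γ⟧ₚ) ?_
  rw [← Path.Homotopic.Quotient.mk_map, ← Path.Homotopic.Quotient.mk_cast]
  congr 1

/-- Mathlib's monodromy homomorphism `π₁(X, x) → ℤᵐᵒᵖ` of the quotient covering, evaluated on the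
class of a loop: the winding number (whatever the chosen point of the fibre). [folklore] -/
theorem fundamentalGroupToMulOpposite_eq (γ : Path x x) (e : (proj : CyclicCover f → X) ⁻¹' {x}) :
    (isAddQuotientCoveringMap_proj (f := f)).fundamentalGroupToMulOpposite e
        (FundamentalGroup.fromPath ⟦γ⟧ₚ) =
      MulOpposite.op (Multiplicative.ofAdd (winding f γ)) := by
  rw [IsAddQuotientCoveringMap.fundamentalGroupToMulOpposite_apply_eq_Iff, MulOpposite.unop_op,
    ofAdd_smul]
  exact congrArg Subtype.val (monodromy_eq γ e).symm

/-- The winding homomorphism is Mathlib's monodromy homomorphism of the infinite cyclic cover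
(read in `ℤ` rather than `ℤᵐᵒᵖ`), for every point of the fibre. [folklore] -/
theorem op_windingHom_eq (e : (proj : CyclicCover f → X) ⁻¹' {x}) (g : FundamentalGroup X x) :
    MulOpposite.op (windingHom f x g) =
      (isAddQuotientCoveringMap_proj (f := f)).fundamentalGroupToMulOpposite e g := by
  induction g using Quotient.inductionOn with | h γ => ?_
  exact (fundamentalGroupToMulOpposite_eq γ e).symm

/-- The kernel of the winding homomorphism is the kernel of the monodromy action on the fibre.
[folklore] -/
theorem ker_windingHom_eq (e : (proj : CyclicCover f → X) ⁻¹' {x}) :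
    (windingHom f x).ker = ((isCoveringMap_proj (f := f)).monodromyPerm x).ker := by
  rw [← isAddQuotientCoveringMap_proj.ker_fundamentalGroupToMulOpposite e]
  ext g
  rw [MonoidHom.mem_ker, MonoidHom.mem_ker, ← op_windingHom_eq e g, ← MulOpposite.op_one,
    MulOpposite.op_inj]

end Lifts

/-! ### The fundamental group of the cover -/

/-- Casting path classes along equalities of end points is injective. [folklore] -/
theorem quotient_cast_injective {Y : Type*} [TopologicalSpace Y] {x y x' y' : Y} (hx : x' = x)
    (hy : y' = y) {γ γ' : Path.Homotopic.Quotient x y} (h : γ.cast hx hy = γ'.cast hx hy) :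
    γ = γ' := by
  subst hx hy
  simpa using h

section FundamentalGroup

variable {x : X}

/-- **The image of `proj_* : π₁(X̃, e) → π₁(X, x)` is the kernel of the winding homomorphism**
(Hatcher 2002, Prop. 1.31 / 1.40: a loop lifts to a loop iff its monodromy fixes the fibre, here
iff its winding number vanishes; Mathlib `IsAddQuotientCoveringMap.ker_monodromyPerm`).
[cite: HatcherAT2002, §1.3 Prop. 1.31] -/
theorem range_mapOfEq_eq_ker (e : CyclicCover f) (he : proj e = x) :
    (FundamentalGroup.mapOfEq (projC f) he).range = (windingHom f x).ker := by
  rw [ker_windingHom_eq ⟨e, he⟩]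
  exact (isAddQuotientCoveringMap_proj.ker_monodromyPerm ⟨e, he⟩).symm

/-- **`proj_* : π₁(X̃, e) → π₁(X, x)` is injective** (Hatcher 2002, Prop. 1.31; Mathlib
`IsCoveringMap.injective_path_homotopic_map`). [cite: HatcherAT2002, §1.3 Prop. 1.31] -/
theorem mapOfEq_injective (e : CyclicCover f) (he : proj e = x) :
    Injective (FundamentalGroup.mapOfEq (projC f) he) := by
  intro a b h
  rw [FundamentalGroup.mapOfEq_apply, FundamentalGroup.mapOfEq_apply] at h
  exact isCoveringMap_proj.injective_path_homotopic_map e e (quotient_cast_injective _ _ h)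

/-- A loop in the base whose winding number vanishes lifts to a loop: its class is in the image of
`proj_*`. [folklore] -/
theorem fromPath_mem_range_mapOfEq (e : CyclicCover f) (he : proj e = x) (γ : Path x x)
    (h : winding f γ = 0) :
    FundamentalGroup.fromPath ⟦γ⟧ₚ ∈ (FundamentalGroup.mapOfEq (projC f) he).range := by
  rw [range_mapOfEq_eq_ker, MonoidHom.mem_ker, windingHom_fromPath, h]
  rfl

/-- **`π₁` of the infinite cyclic cover is the kernel of the winding homomorphism**:
`proj_*` is an isomorphism `π₁(X̃, e) ≃* ker (windingHom f (proj e))`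
(Hatcher 2002, Props. 1.31, 1.40). [cite: HatcherAT2002, §1.3 Prop. 1.40] -/
def fundamentalGroupEquivKer (e : CyclicCover f) :
    FundamentalGroup (CyclicCover f) e ≃* (windingHom f (proj e)).ker :=
  (MonoidHom.ofInjective (mapOfEq_injective e rfl)).trans
    (MulEquiv.subgroupCongr (range_mapOfEq_eq_ker e rfl))

/-- The isomorphism is `proj_*`. [folklore] -/
@[simp]
theorem coe_fundamentalGroupEquivKer (e : CyclicCover f) (g : FundamentalGroup (CyclicCover f) e) :
    (fundamentalGroupEquivKer e g : FundamentalGroup X (proj e)) =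
      FundamentalGroup.mapOfEq (projC f) rfl g :=
  rfl

/-- `proj_*` on the class of a loop in the cover is the class of its projection. [folklore] -/
theorem mapOfEq_fromPath (e : CyclicCover f) (Γ : Path e e) :
    FundamentalGroup.mapOfEq (projC f) rfl (FundamentalGroup.fromPath ⟦Γ⟧ₚ) =
      FundamentalGroup.fromPath ⟦Γ.map continuous_proj⟧ₚ := by
  rw [FundamentalGroup.mapOfEq_apply, Path.Homotopic.Quotient.cast_rfl_rfl]
  rfl

end FundamentalGroup

/-! ### Path-connectedness of the cover -/

section PathConnected

variable {x₀ : X}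

/-- Along the lift of a loop, its starting point is joined to its translate by the winding number.
[folklore] -/
theorem joined_vadd_winding (γ : Path x₀ x₀) (e : CyclicCover f) (he : proj e = x₀) :
    Joined e (winding f γ +ᵥ e) :=
  ⟨(liftPath γ e he).cast rfl (liftEnd_eq_vadd γ e he).symm⟩

/-- If `X` is path connected and some loop winds once, every point of the cover is joined to all
its translates. [folklore] -/
theorem joined_vadd [PathConnectedSpace X] (γ₀ : Path x₀ x₀) (h : winding f γ₀ = 1)
    (e : CyclicCover f) (k : ℤ) : Joined e (k +ᵥ e) := by
  -- a loop at `proj e` winding once, by conjugating `γ₀` with a path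
  have hone : ∀ e' : CyclicCover f, Joined e' ((1 : ℤ) +ᵥ e') := fun e' => by
    let δ : Path (proj e') x₀ := PathConnectedSpace.somePath _ _
    have hw : winding f (δ.trans (γ₀.trans δ.symm)) = 1 := by rw [winding_conj, h]
    simpa [hw] using joined_vadd_winding (δ.trans (γ₀.trans δ.symm)) e' rfl
  induction k using Int.induction_on with
  | zero => simpa using Joined.refl e
  | succ k ih =>
      have := hone ((k : ℤ) +ᵥ e)
      rw [← add_vadd, add_comm] at this
      exact ih.trans this
  | pred k ih =>
      have := hone ((-(k : ℤ) - 1) +ᵥ e)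
      rw [← add_vadd, show (1 : ℤ) + (-(k : ℤ) - 1) = -(k : ℤ) by ring] at this
      exact ih.trans this.symm

/-- **The infinite cyclic cover is path connected** as soon as `X` is path connected and some
loop has winding number `1` (e.g. a meridian of a knot): lift a path between the projections and
correct the end point by a deck transformation. [folklore] -/
theorem pathConnectedSpace_of_winding_eq_one [PathConnectedSpace X] (γ₀ : Path x₀ x₀)
    (h : winding f γ₀ = 1) : PathConnectedSpace (CyclicCover f) := by
  refine ⟨inferInstance, fun p q => ?_⟩
  let δ : Path (proj p) (proj q) := PathConnectedSpace.somePath _ _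
  have h₁ : Joined p (liftEnd δ p rfl) := ⟨liftPath δ p rfl⟩
  obtain ⟨k, hk⟩ := exists_vadd_eq_of_proj_eq (p := liftEnd δ p rfl) (q := q) (by simp)
  rw [← hk] at h₁
  exact h₁.trans (joined_vadd γ₀ h q k).symm

end PathConnected

end CyclicCover

end CircleMaps

end Literature.Topology.FourManifolds
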